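import Literature.NumberTheory.Sieve.LinearEquationsInPrimesSplitVonMangoldt
import Literature.NumberTheory.Sieve.LinearEquationsInPrimesProductNilmanifold
import Literature.NumberTheory.Sieve.LinearEquationsInPrimesInverseU2
import Literature.NumberTheory.Sieve.LinearEquationsInPrimesDivisorMoments
import Mathlib.NumberTheory.Harmonic.Bounds
import Mathlib.Analysis.SpecialFunctions.Complex.Log
import HarnessLib

/-!
# Linear equations in primes: the flat orthogonality (12.7) from `MN(s)` (Green–Tao 2010, §12)

Trunk T-SIEVE (`Literature/NumberTheory/Sieve`), seventh file of the App. E / §11 programme in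
the inline decomposition of the named fact `Literature.NumberTheory.Sieve.GreenTao2010_gowersUniformity`
(B. Green, T. Tao, *Linear equations in primes*, Ann. of Math. 171 (2010), Thm. 7.2). After
`…SplitVonMangoldt.lean`, Prop. 10.2 (hence Thm. 7.2, given `GI(s)` and Lemma E.9) rested on the
two analytic inputs of §12: the sharp Gowers estimate (12.6) and the flat orthogonality (12.7)
`𝔼_{n ∈ [N]} (φ(W)/W) Λ♭(Wn + b) F(gⁿx) = o(1)`. This file PROVES the second half of §12: (12.7)
follows from the Möbius–nilsequences conjecture `MN(s)` (Conj. 8.5 of the paper — now the theorem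
of Green–Tao, Ann. of Math. 175 (2012)), here the predicate `GreenTao2010_MNAt s Y M` (not
asserted), for every nilmanifold whose Lie group is divisible.

## Contents

* `GreenTao2010_MNAt s Y M` — Conj. 8.5 as printed, at the nilmanifold `Y` and Lipschitz bound `M`
  (a predicate); `Nilmanifold.IsDivisible X` — every `g ∈ G` has `q`-th roots ("any Lie group …
  for which `exp` is surjective is divisible … When `G` is simply-connected and nilpotent, `exp` is
  a homeomorphism"), a theorem of Lie theory carried, like Lemma E.9, as a hypothesis, with the
  examples `isDivisible_circle`, `_prod`, `_pow`, `_ofLE`;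
* the nilmanifold algebra of §12: `Nilmanifold.tensorFun` (products of nilsequences on the
  product nilmanifold, Lipschitz constant `K₁ + K₂` for the max metric), the powers
  `Nilmanifold.pow X m` with the diagonal `Nilmanifold.diagHom`,
  `Nilmanifold.exists_pow_nilsequence` (`∏_j H_j(gⁿ y_j)` is a nilsequence on `X^m`) and
  `Nilmanifold.exists_twisted_pow_nilsequence` (`cos(2π(φ + nθ)) ∏_j H_j(gⁿ y_j)` on
  `X^m × ℝ/ℤ`, "Replacing `G/Γ` with `G/Γ × ℝ/ℤ`");
* the elementary lemmas of §12: the character expansion `∑_{r<W} cos(2πrk/W) = W 1_{W ∣ k}`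
  (`sum_cos_two_pi_mul_div`), summation by parts (`sum_Icc_mul_eq_parts`,
  `abs_sum_Icc_mul_le_parts`), the rearrangement `n = de` (`sum_Icc_sum_divisors_eq`,
  `sum_filter_mul_mem_eq_sub`), the substitution `n' = Wn + b`
  (`sum_filter_dvd_sub_eq_sum`, (12.8)) and the twist (`sum_range_sum_twist_eq`);
* the rough weight `flatWeight χ γ N d = χ♭(log d/log R)`, `R = N^γ`, its vanishing for
  `d ≤ R^{1/2}` and its variation; **`abs_sum_moebius_flatWeight_le`** (one dilated Möbius sum:
  `MN`-type partial-sum bounds + summation by parts) and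
  **`abs_sum_divisorSum_flatWeight_mul_le`** ((12.10): the sum over the dilations `e`,
  "absorbing the logarithmically divergent sum `∑ 1/m`");
* **`GreenTao2010_flatOrthogonalAt_of_twisted`** / **`GreenTao2010_flatOrthogonalAt_of_MN`** —
  (12.7) for `X` (in the strong form of `…SplitVonMangoldt.lean`: products along one orbit, all
  subintervals of `[N]`) from `MN(s)` on the nilmanifolds `X^m × ℝ/ℤ`, for `X` divisible, any
  Lipschitz cutoff `χ♯` with `χ♯(x) = x` on `[0, ½]`, and any `γ > 0`;
* the assemblies `GreenTao2010_gowersUniformity_of_malcev_of_GI_of_MN_of_sharp` and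
  `GreenTaoZiegler2012_finiteComplexity_of_malcev_of_GI_of_MN_of_sharp`: Thm. 7.2 (all `s`;
  `s = 1` is unconditional, `…GowersU2.lean`) now rests on exactly `GI(s)` [Green–Tao–Ziegler
  2012], `MN(s)` [Green–Tao 2012], the sharp estimate (12.6) [App. D with `a = 1`], and the two
  Lie-theoretic facts Lemma E.9 and divisibility [Mal'cev].

## The proof of (12.7) (as formalised; §12 of the paper from (12.7) on)

Fix `m, K, ε`; `MN(s)` on `X^m × ℝ/ℤ` at `A = 4` and Lipschitz constant `mK + 2π` gives `C₀`.
For `N` large, `w ≤ ½ log log N` (so `W ≤ log N`), `b ∈ [W]`, `H_j`, `g`, `y_j`, `[lo, hi] ⊆ [N]`: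
write `S = ∑_{n} (φ(W)/W) Λ♭(Wn+b) ∏_j H_j(gⁿy_j) = -(φ(W)/W)(γ log N) T`,
`T = ∑_n c(Wn+b) ∏_j H_j(gⁿ y_j)`, `c(n') = ∑_{d|n'} μ(d) u_N(d)`. With `h^W = g` and
`y'_j = h^{-b} y_j` (so `h^{Wn+b} y'_j = gⁿ y_j`) and `1_{W ∣ n'-b} = W⁻¹ ∑_{r<W} cos(2πr(n'-b)/W)`,
`W T = ∑_{r<W} T_r`, `T_r = ∑_{n' ∈ [Wlo+b, Whi+b]} c(n') Ψ_r(n')`,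
`Ψ_r(n') = cos(2πr(n'-b)/W) ∏_j H_j(h^{n'} y'_j)` — a nilsequence on `X^m × ℝ/ℤ`, as are its
dilations `d ↦ Ψ_r(de)`. Rearranging `n' = de` and reducing to initial segments in `d`,
`|∑_{d ≤ D} μ(d) u_N(d) Ψ_r(de)| ≤ 8(1+L_χ)C₀(4/γ)^4 γ⁻¹ D log^{-4} N` (`u_N` vanishes for
`d ≤ N^{γ/2}`, has size and variation `O((1+L_χ) log D/(γ log N))` beyond, and the partial Möbius
sums are `≤ C₀ t log^{-4} t ≤ C₀ D (4/γ)^4 log^{-4} N` for `t ≥ N^{γ/2}/2`); summing over `e` with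
`∑ 1/e ≤ 1 + log`, `|T_r| ≤ K₀ N''(1 + log N'') log^{-4} N`, `N'' = W hi + b ≤ 2N log N`, whence
`|S| ≤ γ log N · 6K₀ N log^{-2} N = 6γK₀ N/log N ≤ εN`.

## References

* B. Green, T. Tao, *Linear equations in primes*, Ann. of Math. (2) 171 (2010), 1753–1850
  (arXiv:math/0606088): §12 ((12.7)–(12.10)), Conj. 8.5, Def. 11.1.
* B. Green, T. Tao, *The Möbius function is strongly orthogonal to nilsequences*, Ann. of
  Math. (2) 175 (2012), 541–566, Thm. 1.1.
-/

noncomputable section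

open Finset Filter
open scoped BigOperators ArithmeticFunction.Moebius

namespace Literature.NumberTheory.Sieve

namespace Nilmanifold

variable {s : ℕ} (X Y : Nilmanifold s)

/-! ### Tensor products of functions on a product nilmanifold -/

/-- The tensor product `(F₁ ⊗ F₂)(q) = F₁(q₁) F₂(q₂)` of two functions, a function on the product
nilmanifold `(G × G')/(Γ × Γ')` (read through `(G × G')/(Γ × Γ') ≃ G/Γ × G'/Γ'`); products of
nilsequences are nilsequences on the product ("the Lipschitz nilsequences form an algebra";
"Replacing `G/Γ` with `G/Γ × ℝ/ℤ`"). [cite: GreenTao2010, §8 (after Def. 8.1) and §12] -/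
def tensorFun (F₁ : X.G ⧸ X.Γ → ℝ) (F₂ : Y.G ⧸ Y.Γ → ℝ) : (X.G × Y.G) ⧸ X.Γ.prod Y.Γ → ℝ :=
  fun q => F₁ (quotientProdMap X Y q).1 * F₂ (quotientProdMap X Y q).2

/-- The orbit of `(g₁, g₂)` through `(a₁, a₂)Γ` under the tensor product:
`(F₁ ⊗ F₂)((g₁,g₂)ⁿ (a₁,a₂)Γ) = F₁(g₁ⁿ a₁Γ) F₂(g₂ⁿ a₂Γ')`. [folklore] -/
theorem tensorFun_orbit (F₁ : X.G ⧸ X.Γ → ℝ) (F₂ : Y.G ⧸ Y.Γ → ℝ) (g₁ a₁ : X.G) (g₂ a₂ : Y.G)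
    (n : ℕ) :
    tensorFun X Y F₁ F₂ (((g₁, g₂) : X.G × Y.G) ^ n •
        (QuotientGroup.mk ((a₁, a₂) : X.G × Y.G) : (X.G × Y.G) ⧸ X.Γ.prod Y.Γ)) =
      F₁ (g₁ ^ n • (QuotientGroup.mk a₁ : X.G ⧸ X.Γ)) * F₂ (g₂ ^ n • (QuotientGroup.mk a₂ : Y.G ⧸ Y.Γ)) := by
  unfold tensorFun
  rw [MulAction.Quotient.smul_mk, smul_eq_mul, Prod.pow_mk, Prod.mk_mul_mk, quotientProdMap_mk,
    MulAction.Quotient.smul_mk, MulAction.Quotient.smul_mk, smul_eq_mul, smul_eq_mul]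

/-- The metric of the product is the max metric (by construction). [folklore] -/
theorem prod_dist_eq (p q : (X.G × Y.G) ⧸ X.Γ.prod Y.Γ) :
    (X.prod Y).dist p q = max (X.dist (quotientProdMap X Y p).1 (quotientProdMap X Y q).1)
      (Y.dist (quotientProdMap X Y p).2 (quotientProdMap X Y q).2) := rfl

/-- **Tensor products of `1`-bounded Lipschitz functions are `1`-bounded Lipschitz** on the product
(with the max metric), constant `K₁ + K₂`. [cite: GreenTao2010, §8 (after Def. 8.1)] -/
theorem isBoundedLipschitz_tensorFun {K₁ K₂ : ℝ} (hK₁ : 0 ≤ K₁) (hK₂ : 0 ≤ K₂)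
    {F₁ : X.G ⧸ X.Γ → ℝ} {F₂ : Y.G ⧸ Y.Γ → ℝ} (h₁ : X.IsBoundedLipschitz K₁ F₁)
    (h₂ : Y.IsBoundedLipschitz K₂ F₂) :
    (X.prod Y).IsBoundedLipschitz (K₁ + K₂) (tensorFun X Y F₁ F₂) := by
  refine ⟨fun q => ?_, fun p q => ?_⟩
  · unfold tensorFun
    rw [abs_mul]
    calc |F₁ (quotientProdMap X Y q).1| * |F₂ (quotientProdMap X Y q).2| ≤ 1 * 1 :=
          mul_le_mul (h₁.1 _) (h₂.1 _) (abs_nonneg _) zero_le_one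
      _ = 1 := one_mul 1
  · rw [prod_dist_eq]
    unfold tensorFun
    set p₁ := (quotientProdMap X Y p).1
    set p₂ := (quotientProdMap X Y p).2
    set q₁ := (quotientProdMap X Y q).1
    set q₂ := (quotientProdMap X Y q).2
    have hd₁ := X.dist_nonneg p₁ q₁
    have hd₂ := Y.dist_nonneg p₂ q₂
    have e : F₁ p₁ * F₂ p₂ - F₁ q₁ * F₂ q₂ = (F₁ p₁ - F₁ q₁) * F₂ p₂ + F₁ q₁ * (F₂ p₂ - F₂ q₂) := by ring
    rw [e]
    calc |(F₁ p₁ - F₁ q₁) * F₂ p₂ + F₁ q₁ * (F₂ p₂ - F₂ q₂)|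
        ≤ |(F₁ p₁ - F₁ q₁) * F₂ p₂| + |F₁ q₁ * (F₂ p₂ - F₂ q₂)| := abs_add_le _ _
      _ = |F₁ p₁ - F₁ q₁| * |F₂ p₂| + |F₁ q₁| * |F₂ p₂ - F₂ q₂| := by rw [abs_mul, abs_mul]
      _ ≤ K₁ * X.dist p₁ q₁ * 1 + 1 * (K₂ * Y.dist p₂ q₂) :=
          add_le_add (mul_le_mul (h₁.2 _ _) (h₂.1 _) (abs_nonneg _) (mul_nonneg hK₁ hd₁))
            (mul_le_mul (h₁.1 _) (h₂.2 _ _) (abs_nonneg _) zero_le_one)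
      _ ≤ K₁ * max (X.dist p₁ q₁) (Y.dist p₂ q₂) + K₂ * max (X.dist p₁ q₁) (Y.dist p₂ q₂) := by
          rw [mul_one, one_mul]
          exact add_le_add (mul_le_mul_of_nonneg_left (le_max_left _ _) hK₁)
            (mul_le_mul_of_nonneg_left (le_max_right _ _) hK₂)
      _ = (K₁ + K₂) * max (X.dist p₁ q₁) (Y.dist p₂ q₂) := by ring

/-! ### Powers of a nilmanifold and diagonal orbits -/

/-- The power `X^m = X × (X × ⋯ × (X × pt))` of a nilmanifold, an `s`-step nilmanifold
(iterated `Nilmanifold.prod`, `X^0` the one-point nilmanifold). Averaged nilsequences and the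
product nilsequences of §12 live on such powers ("`F₁` is an averaged nilsequence on
`(G/Γ)^{2^{s+1}-1}`"). [cite: GreenTao2010, Def. 11.1 (Remark) and Prop. 11.2] -/
def pow : ℕ → Nilmanifold s
  | 0 => point s
  | m + 1 => X.prod (pow m)

/-- The diagonal embedding `g ↦ (g, g, …, g)` of `G` into the group `G^m` of `X^m`, a group
homomorphism (so that dilations `g ↦ g^e` and roots commute with it). [folklore] -/
def diagHom : (m : ℕ) → X.G →* (X.pow m).G
  | 0 => 1
  | m + 1 => (MonoidHom.id X.G).prod (diagHom m)

/-- **Products of nilsequences on `X` along one orbit direction are nilsequences on `X^m`**: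
for `1`-bounded `K`-Lipschitz `H_j` and base points `y_j` there are a `1`-bounded
`(mK)`-Lipschitz `F` on `X^m` and a base point `aΓ` with
`F((g,…,g)ⁿ aΓ) = ∏_j H_j(gⁿ y_j)` for every `g ∈ G` and `n` (the same `F`, `a` for all `g`).
[cite: GreenTao2010, §11 (proof of Prop. 11.2, "the Lipschitz nilsequences form an algebra") and §12] -/
theorem exists_pow_nilsequence (m : ℕ) {K : ℝ} (hK : 0 ≤ K) (H : Fin m → X.G ⧸ X.Γ → ℝ)
    (hH : ∀ j, X.IsBoundedLipschitz K (H j)) (y : Fin m → X.G ⧸ X.Γ) :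
    ∃ (F : (X.pow m).G ⧸ (X.pow m).Γ → ℝ) (a : (X.pow m).G),
      (X.pow m).IsBoundedLipschitz (m * K) F ∧
        ∀ (g : X.G) (n : ℕ),
          F ((X.diagHom m g) ^ n • (QuotientGroup.mk a : (X.pow m).G ⧸ (X.pow m).Γ)) =
            ∏ j, H j (g ^ n • y j) := by
  induction m with
  | zero =>
    refine ⟨fun _ => 1, 1, ⟨fun _ => by simp, fun p q => ?_⟩, fun g n => ?_⟩
    · rw [sub_self, abs_zero, Nat.cast_zero, zero_mul, zero_mul]
    · simp
  | succ m ih =>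
    obtain ⟨F', a', hF', horb⟩ := ih (fun j => H j.succ) (fun j => hH j.succ) (fun j => y j.succ)
    obtain ⟨a₀, ha₀⟩ := QuotientGroup.mk_surjective (y 0)
    refine ⟨tensorFun X (X.pow m) (H 0) F', ((a₀, a') : X.G × (X.pow m).G), ?_, fun g n => ?_⟩
    · have hmK : (0 : ℝ) ≤ m * K := by positivity
      have h := isBoundedLipschitz_tensorFun X (X.pow m) hK hmK (hH 0) hF'
      have e : ((m + 1 : ℕ) : ℝ) * K = K + m * K := by push_cast; ring
      rw [e]
      exact h
    · change tensorFun X (X.pow m) (H 0) F' ((((g, X.diagHom m g) : X.G × (X.pow m).G)) ^ n •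
        (QuotientGroup.mk ((a₀, a') : X.G × (X.pow m).G) :
          (X.G × (X.pow m).G) ⧸ X.Γ.prod (X.pow m).Γ)) = _
      rw [tensorFun_orbit, horb g n, ha₀, Fin.prod_univ_succ]

/-! ### Twisting by a circle character -/

/-- **Twisted product nilsequences**: for `s ≥ 1`, `1`-bounded `K`-Lipschitz `H_j` on `X`, base
points `y_j`, there are a `1`-bounded `(mK + 2π)`-Lipschitz function `F` on the `s`-step
nilmanifold `X^m × ℝ/ℤ` and a base point such that for every `g ∈ G`, every frequency `θ` and
phase `φ`, `n ↦ cos(2π(φ + nθ)) ∏_j H_j(gⁿ y_j)` is the nilsequence of `F` along the orbit of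
`((g,…,g), θ)` ("each function `n ↦ e(rn/W)` may be realised as a `1`-bounded, `O(1)`-Lipschitz
nilsequence on the `1`-step nilmanifold `ℝ/ℤ`. Replacing `G/Γ` with `G/Γ × ℝ/ℤ` …").
[cite: GreenTao2010, §12 (between (12.9) and (12.10))] -/
theorem exists_twisted_pow_nilsequence (hs : 1 ≤ s) (m : ℕ) {K : ℝ} (hK : 0 ≤ K)
    (H : Fin m → X.G ⧸ X.Γ → ℝ) (hH : ∀ j, X.IsBoundedLipschitz K (H j)) (y : Fin m → X.G ⧸ X.Γ) :
    ∃ (F : ((X.pow m).G × (circle.ofLE hs).G) ⧸ (X.pow m).Γ.prod (circle.ofLE hs).Γ → ℝ)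
      (a : (X.pow m).G),
      ((X.pow m).prod (circle.ofLE hs)).IsBoundedLipschitz (m * K + 2 * Real.pi) F ∧
        ∀ (g : X.G) (θ φ : ℝ) (n : ℕ),
          F ((((X.diagHom m g, Multiplicative.ofAdd θ) : (X.pow m).G × (circle.ofLE hs).G)) ^ n •
              (QuotientGroup.mk ((a, Multiplicative.ofAdd φ) : (X.pow m).G × (circle.ofLE hs).G) :
                ((X.pow m).G × (circle.ofLE hs).G) ⧸ (X.pow m).Γ.prod (circle.ofLE hs).Γ)) =
            Real.cos (2 * Real.pi * (φ + n * θ)) * ∏ j, H j (g ^ n • y j) := by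
  obtain ⟨F₁, a, hF₁, horb⟩ := X.exists_pow_nilsequence m hK H hH y
  have hcos : (circle.ofLE hs).IsBoundedLipschitz (2 * Real.pi) cosCircle :=
    (isBoundedLipschitz_ofLE circle hs (2 * Real.pi) cosCircle).mpr isBoundedLipschitz_cosCircle
  refine ⟨tensorFun (X.pow m) (circle.ofLE hs) F₁ cosCircle, a,
    isBoundedLipschitz_tensorFun (X.pow m) (circle.ofLE hs) (by positivity) Real.two_pi_pos.le hF₁ hcos,
    fun g θ φ n => ?_⟩
  rw [tensorFun_orbit, horb g n, mul_comm]
  congr 1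
  have h := nilsequence_cosCircle θ φ n
  rw [Nilmanifold.nilsequence] at h
  exact h

end Nilmanifold

/-! ### The `MN(s)` conjecture and divisibility, as predicates -/

/-- **The `MN(s)` conjecture at the nilmanifold `Y` and Lipschitz bound `M`** (Green–Tao 2010,
Conj. 8.5, as printed: "Let `G/Γ = (G/Γ, d_{G/Γ})` be an `s`-step nilmanifold with smooth metric
`d_{G/Γ}`, and let `(F(gⁿx))_{n ∈ [N]}` be a bounded `s`-step nilsequence with Lipschitz constant
`M`. Then we have the bound `|𝔼_{n ≤ N} μ(n) F(gⁿ x)| ≪_{A,M,G/Γ,s} log^{-A} N` for any real number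
`A > 0`." — "It is important to note that the implied constant is not allowed to depend on `g` and
`x`"), now the theorem of B. Green, T. Tao, Ann. of Math. 175 (2012). A predicate (hypothesis of the
reduction below), not asserted here. [cite: GreenTao2010, Conj. 8.5] -/
def GreenTao2010_MNAt (s : ℕ) (Y : Nilmanifold s) (M : ℝ) : Prop :=
  ∀ A : ℝ, 0 < A → ∃ C : ℝ, ∀ N : ℕ, 2 ≤ N →
    ∀ (g : Y.G) (x : Y.G ⧸ Y.Γ) (F : Y.G ⧸ Y.Γ → ℝ), Y.IsBoundedLipschitz M F →
      |∑ n ∈ Finset.Icc 1 N, (ArithmeticFunction.moebius n : ℝ) * F (g ^ n • x)| ≤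
        C * N / Real.log N ^ A

namespace Nilmanifold

/-- **Divisibility of the Lie group of a nilmanifold**, as a hypothesis: every `g ∈ G` has a
`q`-th root for every `q ≥ 1` ("any Lie group `G` over `ℝ` for which the exponential map
`exp : 𝔤 → G` … is surjective is divisible … When `G` is simply-connected and nilpotent, `exp` is
a homeomorphism"). A theorem for every connected, simply connected nilpotent Lie group; its
proof needs the Lie correspondence, absent from Mathlib, so — like Lemma E.9
(`Nilmanifold.IsRational`) — it is carried as an explicit hypothesis, immediate for `ℝ`, the
Heisenberg group and products. [cite: GreenTao2010, §12 (before (12.9))] -/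
def IsDivisible {s : ℕ} (X : Nilmanifold s) : Prop :=
  ∀ (g : X.G) (q : ℕ), 1 ≤ q → ∃ h : X.G, h ^ q = g

end Nilmanifold

/-! ### Elementary lemmas for §12 -/

section elementary

/-- **Detecting a residue class by cosines**: `∑_{r < W} cos(2π r k / W) = W · 1_{W ∣ k}` (the
real part of `1_{n ≡ b (W)} = W⁻¹ ∑_{r ∈ ℤ_W} e(-rb/W) e(rn/W)`, with `k = n - b`).
[cite: GreenTao2010, §12 (before (12.10))] -/
theorem sum_cos_two_pi_mul_div {W : ℕ} (hW : 1 ≤ W) (k : ℤ) :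
    ∑ r ∈ Finset.range W, Real.cos (2 * Real.pi * (r * k / W)) =
      if (W : ℤ) ∣ k then (W : ℝ) else 0 := by
  have hW0 : (W : ℂ) ≠ 0 := by exact_mod_cast (show W ≠ 0 by omega)
  have hI : (2 * Real.pi * Complex.I : ℂ) ≠ 0 := by
    simp [Real.pi_ne_zero, Complex.I_ne_zero]
  set z : ℂ := Complex.exp (2 * Real.pi * Complex.I * (k / W)) with hz
  have hzr : ∀ r : ℕ, z ^ r = Complex.exp (2 * Real.pi * Complex.I * (r * k / W)) := by
    intro r
    rw [hz, ← Complex.exp_nat_mul]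
    congr 1
    ring
  have hre : ∀ r : ℕ, (Complex.exp (2 * Real.pi * Complex.I * (r * k / W))).re =
      Real.cos (2 * Real.pi * (r * k / W)) := by
    intro r
    have : (2 * Real.pi * Complex.I * (r * k / W) : ℂ) =
        ((2 * Real.pi * (r * k / W) : ℝ) : ℂ) * Complex.I := by push_cast; ring
    rw [this, Complex.exp_ofReal_mul_I_re]
  have hsum : ∑ r ∈ Finset.range W, Real.cos (2 * Real.pi * (r * k / W)) =
      (∑ r ∈ Finset.range W, z ^ r).re := by
    rw [Complex.re_sum]
    exact Finset.sum_congr rfl fun r _ => by rw [hzr, hre]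
  rw [hsum]
  have hzW : z ^ W = 1 := by
    rw [hzr W]
    have : (2 * Real.pi * Complex.I * ((W : ℕ) * k / W) : ℂ) = k * (2 * Real.pi * Complex.I) := by
      field_simp
    rw [this]
    exact Complex.exp_int_mul_two_pi_mul_I k
  split_ifs with hdvd
  · obtain ⟨q, rfl⟩ := hdvd
    have hz1 : z = 1 := by
      rw [hz]
      have : (2 * Real.pi * Complex.I * ((((W : ℤ) * q : ℤ) : ℂ) / W) : ℂ) =
          q * (2 * Real.pi * Complex.I) := by
        push_cast
        field_simp
      rw [this]
      exact Complex.exp_int_mul_two_pi_mul_I q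
    simp [hz1]
  · have hz1 : z ≠ 1 := by
      intro h1
      rw [hz, Complex.exp_eq_one_iff] at h1
      obtain ⟨n, hn⟩ := h1
      apply hdvd
      have h2 : (k : ℂ) / W = n := by
        have : (2 * Real.pi * Complex.I : ℂ) * (k / W) = (2 * Real.pi * Complex.I) * n := by
          rw [hn]; ring
        exact mul_left_cancel₀ hI this
      rw [div_eq_iff hW0] at h2
      have h3 : (k : ℂ) = ((n * W : ℤ) : ℂ) := by rw [h2]; push_cast; ring
      exact ⟨n, by rw [mul_comm]; exact_mod_cast h3⟩
    rw [geom_sum_eq hz1, hzW, sub_self, zero_div, Complex.zero_re]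

/-- **Summation by parts** on `[a, b]`:
`∑_{d=a}^{b} u_d v_d = u_b V_b - ∑_{d=a}^{b-1} (u_{d+1} - u_d) V_d`, `V_t = ∑_{i=a}^{t} v_i`.
[cite: GreenTao2010, §12 ("a straightforward summation by parts to remove the smooth cutoff `χ♭`")] -/
theorem sum_Icc_mul_eq_parts (u v : ℕ → ℝ) {a b : ℕ} (hab : a ≤ b) :
    ∑ d ∈ Icc a b, u d * v d =
      u b * (∑ i ∈ Icc a b, v i) - ∑ d ∈ Ico a b, (u (d + 1) - u d) * ∑ i ∈ Icc a d, v i := by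
  induction b, hab using Nat.le_induction with
  | base => simp
  | succ b hab ih =>
    rw [Finset.sum_Icc_succ_top (by omega), ih, Finset.sum_Icc_succ_top (by omega),
      Finset.sum_Ico_succ_top hab]
    ring

/-- **The summation-by-parts bound**: if all partial sums `|∑_{i=a}^{t} v_i| ≤ M` (`t ∈ [a,b]`),
then `|∑_{d=a}^{b} u_d v_d| ≤ (|u_b| + ∑_{d=a}^{b-1} |u_{d+1} - u_d|) M`. [folklore] -/
theorem abs_sum_Icc_mul_le_parts (u v : ℕ → ℝ) (a b : ℕ) {M : ℝ} (hM : 0 ≤ M)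
    (hP : ∀ t ∈ Icc a b, |∑ i ∈ Icc a t, v i| ≤ M) :
    |∑ d ∈ Icc a b, u d * v d| ≤ (|u b| + ∑ d ∈ Ico a b, |u (d + 1) - u d|) * M := by
  rcases lt_or_ge b a with hba | hab
  · rw [Finset.Icc_eq_empty (by omega), Finset.sum_empty, abs_zero]
    positivity
  rw [sum_Icc_mul_eq_parts u v hab]
  have h1 : |u b * ∑ i ∈ Icc a b, v i| ≤ |u b| * M := by
    rw [abs_mul]
    exact mul_le_mul_of_nonneg_left (hP b (Finset.mem_Icc.mpr ⟨hab, le_rfl⟩)) (abs_nonneg _)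
  have h2 : |∑ d ∈ Ico a b, (u (d + 1) - u d) * ∑ i ∈ Icc a d, v i| ≤
      (∑ d ∈ Ico a b, |u (d + 1) - u d|) * M := by
    rw [Finset.sum_mul]
    refine (Finset.abs_sum_le_sum_abs _ _).trans (Finset.sum_le_sum fun d hd => ?_)
    rw [Finset.mem_Ico] at hd
    rw [abs_mul]
    exact mul_le_mul_of_nonneg_left (hP d (Finset.mem_Icc.mpr ⟨hd.1, hd.2.le⟩)) (abs_nonneg _)
  calc _ ≤ |u b * ∑ i ∈ Icc a b, v i| + |∑ d ∈ Ico a b, (u (d + 1) - u d) * ∑ i ∈ Icc a d, v i| :=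
        abs_sub _ _
    _ ≤ |u b| * M + (∑ d ∈ Ico a b, |u (d + 1) - u d|) * M := add_le_add h1 h2
    _ = (|u b| + ∑ d ∈ Ico a b, |u (d + 1) - u d|) * M := by ring

/-- **Switching the order of a divisor double sum** ("The left-hand side may be rearranged as
`∑_{m ∈ [N]} ∑_{d ∈ [N/m]} …`"): `∑_{n ∈ [A,B]} ∑_{d | n} f(d, n) = ∑_{e ≤ B} ∑_{d ≤ B : A ≤ de ≤ B} f(d, de)`.
[cite: GreenTao2010, §12 (proof of (12.10))] -/
theorem sum_Icc_sum_divisors_eq {A B : ℕ} (hA : 1 ≤ A) (f : ℕ → ℕ → ℝ) :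
    ∑ n ∈ Icc A B, ∑ d ∈ n.divisors, f d n =
      ∑ e ∈ Icc 1 B, ∑ d ∈ (Icc 1 B).filter (fun d => A ≤ d * e ∧ d * e ≤ B), f d (d * e) := by
  classical
  -- divisors as a filter of `[1, B]`
  have hdiv : ∀ n ∈ Icc A B, ∑ d ∈ n.divisors, f d n =
      ∑ d ∈ Icc 1 B, if d ∣ n then f d n else 0 := by
    intro n hn
    rw [Finset.mem_Icc] at hn
    rw [← Finset.sum_filter]
    congr 1
    ext d
    rw [Nat.mem_divisors, Finset.mem_filter, Finset.mem_Icc]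
    constructor
    · rintro ⟨hd, hn0⟩
      have hdn := Nat.le_of_dvd (by omega) hd
      exact ⟨⟨Nat.pos_of_dvd_of_pos hd (by omega), hdn.trans hn.2⟩, hd⟩
    · rintro ⟨-, hd⟩
      exact ⟨hd, by omega⟩
  rw [Finset.sum_congr rfl hdiv, Finset.sum_comm]
  -- for each `d`, reindex `n = d e`
  have hinner : ∀ d ∈ Icc 1 B, ∑ n ∈ Icc A B, (if d ∣ n then f d n else 0) =
      ∑ e ∈ (Icc 1 B).filter (fun e => A ≤ d * e ∧ d * e ≤ B), f d (d * e) := by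
    intro d hd
    rw [Finset.mem_Icc] at hd
    rw [← Finset.sum_filter]
    symm
    refine Finset.sum_nbij' (fun e => d * e) (fun n => n / d) ?_ ?_ ?_ ?_ ?_
    · intro e he
      rw [Finset.mem_filter, Finset.mem_Icc] at he
      rw [Finset.mem_filter, Finset.mem_Icc]
      exact ⟨⟨he.2.1, he.2.2⟩, Dvd.intro e rfl⟩
    · intro n hn
      rw [Finset.mem_filter, Finset.mem_Icc] at hn
      obtain ⟨⟨hAn, hnB⟩, ⟨e, rfl⟩⟩ := hn
      rw [Finset.mem_filter, Finset.mem_Icc, Nat.mul_div_cancel_left e (by omega)]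
      refine ⟨⟨?_, ?_⟩, hAn, hnB⟩
      · rcases Nat.eq_zero_or_pos e with h | h
        · subst h; simp at hAn; omega
        · exact h
      · calc e ≤ d * e := Nat.le_mul_of_pos_left e (by omega)
          _ ≤ B := hnB
    · intro e _
      exact Nat.mul_div_cancel_left e (by omega)
    · intro n hn
      rw [Finset.mem_filter] at hn
      exact Nat.mul_div_cancel' hn.2
    · intro e _
      rfl
  rw [Finset.sum_congr rfl hinner]
  -- swap the two summations
  have e1 : ∀ d ∈ Icc 1 B, ∑ e ∈ (Icc 1 B).filter (fun e => A ≤ d * e ∧ d * e ≤ B), f d (d * e) =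
      ∑ e ∈ Icc 1 B, if A ≤ d * e ∧ d * e ≤ B then f d (d * e) else 0 := fun d _ =>
    Finset.sum_filter _ _
  have e2 : ∀ e ∈ Icc 1 B, ∑ d ∈ (Icc 1 B).filter (fun d => A ≤ d * e ∧ d * e ≤ B), f d (d * e) =
      ∑ d ∈ Icc 1 B, if A ≤ d * e ∧ d * e ≤ B then f d (d * e) else 0 := fun e _ =>
    Finset.sum_filter _ _
  rw [Finset.sum_congr rfl e1, Finset.sum_congr rfl e2, Finset.sum_comm]

/-- **From the window to initial segments**: for `e ≥ 1`,
`∑_{d ≤ B : A ≤ de ≤ B} F(d) = ∑_{d ≤ ⌊B/e⌋} F(d) - ∑_{d ≤ ⌊(A-1)/e⌋} F(d)`. [folklore] -/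
theorem sum_filter_mul_mem_eq_sub {A B e : ℕ} (hA : 1 ≤ A) (hAB : A ≤ B + 1) (he : 1 ≤ e)
    (F : ℕ → ℝ) :
    ∑ d ∈ (Icc 1 B).filter (fun d => A ≤ d * e ∧ d * e ≤ B), F d =
      ∑ d ∈ Icc 1 (B / e), F d - ∑ d ∈ Icc 1 ((A - 1) / e), F d := by
  have he0 : 0 < e := he
  have hset1 : (Icc 1 B).filter (fun d => A ≤ d * e ∧ d * e ≤ B) =
      (Icc 1 (B / e)).filter (fun d => A ≤ d * e) := by
    ext d
    simp only [Finset.mem_filter, Finset.mem_Icc, Nat.le_div_iff_mul_le he0]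
    constructor
    · rintro ⟨⟨h1, -⟩, hA', hB'⟩
      exact ⟨⟨h1, hB'⟩, hA'⟩
    · rintro ⟨⟨h1, hB'⟩, hA'⟩
      refine ⟨⟨h1, ?_⟩, hA', hB'⟩
      calc d ≤ d * e := Nat.le_mul_of_pos_right d he0
        _ ≤ B := hB'
  have hset2 : (Icc 1 (B / e)).filter (fun d => ¬ A ≤ d * e) = Icc 1 ((A - 1) / e) := by
    ext d
    simp only [Finset.mem_filter, Finset.mem_Icc, not_le, Nat.le_div_iff_mul_le he0]
    constructor
    · rintro ⟨⟨h1, -⟩, hlt⟩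
      exact ⟨h1, by omega⟩
    · rintro ⟨h1, h2⟩
      refine ⟨⟨h1, ?_⟩, by omega⟩
      omega
  rw [hset1, eq_sub_iff_add_eq, ← hset2]
  exact Finset.sum_filter_add_sum_filter_not _ _ _

end elementary

/-! ### The rough weight `u_N(d) = χ♭(log d / log R)`, `R = N^γ` -/

section flatweight

variable {χ : ℝ → ℝ} {Lχ γ : ℝ}

/-- The rough weight `u_N(d) = χ♭(log d/(γ log N)) = χ♭(log d/log R)`, `R = N^γ`, of the
divisor `d` in `Λ♭` (display (12.3)). [cite: GreenTao2010, §12, (12.3)] -/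
def flatWeight (χ : ℝ → ℝ) (γ : ℝ) (N d : ℕ) : ℝ :=
  flatCutoff χ (Real.log d / (γ * Real.log N))

/-- The normalised logarithm `log d/(γ log N)` is nonnegative for `d ≥ 1`, `N > 1`. [folklore] -/
theorem log_div_nonneg (hγ : 0 < γ) {N d : ℕ} (hN : 1 < N) (hd1 : 1 ≤ d) :
    0 ≤ Real.log d / (γ * Real.log N) := by
  have hlogN : 0 < Real.log N := Real.log_pos (by exact_mod_cast hN)
  exact div_nonneg (Real.log_nonneg (by exact_mod_cast hd1)) (by positivity)

/-- **`χ♭` kills the small divisors**: `u_N(d) = 0` for `1 ≤ d ≤ R^{1/2} = N^{γ/2}` ("Observe that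
`χ♭` is supported on `|x| ≥ 1/2`, and so the summand vanishes unless `d ≥ R^{1/2}`").
[cite: GreenTao2010, §12 (proof of (12.10))] -/
theorem flatWeight_eq_zero (hχ0 : ∀ x, 0 ≤ x → x ≤ 1 / 2 → χ x = x) (hγ : 0 < γ) {N d : ℕ}
    (hN : 1 < N) (hd1 : 1 ≤ d) (hd : (d : ℝ) ≤ (N : ℝ) ^ (γ / 2)) : flatWeight χ γ N d = 0 := by
  have hNr : (1 : ℝ) < N := by exact_mod_cast hN
  have hlogN : 0 < Real.log N := Real.log_pos hNr
  have hx0 := log_div_nonneg hγ hN hd1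
  have hx : Real.log d / (γ * Real.log N) ≤ 1 / 2 := by
    rw [div_le_iff₀ (by positivity)]
    have h1 : Real.log d ≤ Real.log ((N : ℝ) ^ (γ / 2)) :=
      Real.log_le_log (by exact_mod_cast hd1) hd
    rw [Real.log_rpow (by linarith)] at h1
    linarith
  unfold flatWeight flatCutoff
  rw [hχ0 _ hx0 hx, sub_self]

/-- `|u_N(d)| ≤ (1 + L_χ) log d/(γ log N)` (`χ(0) = 0` and `χ` is `L_χ`-Lipschitz). [folklore] -/
theorem abs_flatWeight_le (hχ0 : ∀ x, 0 ≤ x → x ≤ 1 / 2 → χ x = x)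
    (hχL : ∀ x y, |χ x - χ y| ≤ Lχ * |x - y|) (hγ : 0 < γ) {N d : ℕ} (hN : 1 < N) (hd1 : 1 ≤ d) :
    |flatWeight χ γ N d| ≤ (1 + Lχ) * (Real.log d / (γ * Real.log N)) := by
  have hx0 := log_div_nonneg hγ hN hd1
  set x := Real.log d / (γ * Real.log N) with hx
  have hχ00 : χ 0 = 0 := hχ0 0 le_rfl (by norm_num)
  have h1 : |χ x| ≤ Lχ * x := by
    have := hχL x 0
    rw [hχ00, sub_zero, sub_zero, abs_of_nonneg hx0] at this
    exact this
  unfold flatWeight flatCutoff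
  rw [← hx]
  calc |x - χ x| ≤ |x| + |χ x| := abs_sub _ _
    _ ≤ x + Lχ * x := add_le_add (le_of_eq (abs_of_nonneg hx0)) h1
    _ = (1 + Lχ) * x := by ring

/-- `|u_N(d+1) - u_N(d)| ≤ (1 + L_χ)(log(d+1) - log d)/(γ log N)`. [folklore] -/
theorem abs_flatWeight_succ_sub_le (hχL : ∀ x y, |χ x - χ y| ≤ Lχ * |x - y|) (hγ : 0 < γ)
    {N d : ℕ} (hN : 1 < N) (hd1 : 1 ≤ d) :
    |flatWeight χ γ N (d + 1) - flatWeight χ γ N d| ≤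
      (1 + Lχ) * (Real.log ((d + 1 : ℕ) : ℝ) / (γ * Real.log N) - Real.log d / (γ * Real.log N)) := by
  have hNr : (1 : ℝ) < N := by exact_mod_cast hN
  have hlogN : 0 < Real.log N := Real.log_pos hNr
  set x := Real.log d / (γ * Real.log N) with hx
  set x' := Real.log ((d + 1 : ℕ) : ℝ) / (γ * Real.log N) with hx'
  have hxx' : x ≤ x' := by
    rw [hx, hx']
    refine div_le_div_of_nonneg_right ?_ (by positivity)
    exact Real.log_le_log (by exact_mod_cast hd1) (by push_cast; linarith)
  unfold flatWeight flatCutoff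
  rw [← hx, ← hx']
  have e : x' - χ x' - (x - χ x) = (x' - x) - (χ x' - χ x) := by ring
  rw [e]
  calc |(x' - x) - (χ x' - χ x)| ≤ |x' - x| + |χ x' - χ x| := abs_sub _ _
    _ ≤ (x' - x) + Lχ * |x' - x| := add_le_add (le_of_eq (abs_of_nonneg (by linarith))) (hχL _ _)
    _ = (1 + Lχ) * (x' - x) := by rw [abs_of_nonneg (by linarith)]; ring

/-- The total variation of `u_N` on `[a, b]` telescopes:
`∑_{d=a}^{b-1} |u_N(d+1) - u_N(d)| ≤ (1 + L_χ)(log b - log a)/(γ log N)`. [folklore] -/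
theorem sum_abs_flatWeight_sub_le (hχL : ∀ x y, |χ x - χ y| ≤ Lχ * |x - y|) (hγ : 0 < γ)
    {N a b : ℕ} (hN : 1 < N) (ha : 1 ≤ a) (hab : a ≤ b) :
    ∑ d ∈ Ico a b, |flatWeight χ γ N (d + 1) - flatWeight χ γ N d| ≤
      (1 + Lχ) * (Real.log b / (γ * Real.log N) - Real.log a / (γ * Real.log N)) := by
  set x : ℕ → ℝ := fun t => Real.log t / (γ * Real.log N) with hx
  calc ∑ d ∈ Ico a b, |flatWeight χ γ N (d + 1) - flatWeight χ γ N d|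
      ≤ ∑ d ∈ Ico a b, (1 + Lχ) * (x (d + 1) - x d) := by
        refine Finset.sum_le_sum fun d hd => ?_
        rw [Finset.mem_Ico] at hd
        have := abs_flatWeight_succ_sub_le hχL hγ hN (le_trans ha hd.1) (d := d)
        simpa only [hx] using this
    _ = (1 + Lχ) * (x b - x a) := by
        rw [← Finset.mul_sum, Finset.sum_Ico_eq_sum_range]
        congr 1
        have h := Finset.sum_range_sub (fun k => x (a + k)) (b - a)
        rw [show a + (b - a) = b by omega, add_zero] at h
        rw [← h]
        refine Finset.sum_congr rfl fun k _ => ?_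
        rw [show a + (k + 1) = a + k + 1 by ring]

end flatweight

/-! ### The dilated Möbius sums with the rough weight (proof of (12.10)) -/

section flatcore

variable {χ : ℝ → ℝ} {Lχ γ : ℝ}

/-- **The bound for one dilated, weighted Möbius sum** ("We now apply the conjecture `MN(s)`.
Together with a straightforward summation by parts to remove the smooth cutoff `χ♭` this shows that
`|∑_{d ∈ [N/m]} μ(d) χ♭(log d/log R) F((g^m)^d x)| ≪ (N/m) log^{-A}(N/m)` … Since `m ≤ N/R^{1/2}`,
we see that `log^{-A}(N/m) ≪_A log^{-A} N`"): if the partial sums of `μ(d) Ψ(de)` obey the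
`MN`-type bound `|∑_{d ≤ t} μ(d)Ψ(de)| ≤ C t log^{-A} t` (`t ≥ 2`), then for `D ≤ N²` (and
`N^{γ/4} ≥ 2`)
`|∑_{d ≤ D} μ(d) u_N(d) Ψ(de)| ≤ 8 (1 + L_χ) C (4/γ)^A γ⁻¹ · D log^{-A} N`.
[cite: GreenTao2010, §12 (proof of (12.10))] -/
theorem abs_sum_moebius_flatWeight_le (hχ0 : ∀ x, 0 ≤ x → x ≤ 1 / 2 → χ x = x)
    (hχL : ∀ x y, |χ x - χ y| ≤ Lχ * |x - y|) (hLχ : 0 ≤ Lχ) (hγ : 0 < γ) {A C : ℝ} (hA : 0 < A)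
    (hC : 0 ≤ C) {N : ℕ} (hN : 16 ≤ N) (hNγ : (2 : ℝ) ≤ (N : ℝ) ^ (γ / 4)) (Ψ : ℕ → ℝ) (e : ℕ)
    (hP : ∀ t : ℕ, 2 ≤ t →
      |∑ d ∈ Icc 1 t, (ArithmeticFunction.moebius d : ℝ) * Ψ (d * e)| ≤ C * t / Real.log t ^ A)
    {D : ℕ} (hD : (D : ℝ) ≤ (N : ℝ) ^ 2) :
    |∑ d ∈ Icc 1 D, (ArithmeticFunction.moebius d : ℝ) * flatWeight χ γ N d * Ψ (d * e)| ≤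
      8 * (1 + Lχ) * C * (4 / γ) ^ A / γ * D / Real.log N ^ A := by
  have hN1 : 1 < N := by omega
  have hNr : (16 : ℝ) ≤ N := by exact_mod_cast hN
  have hN0 : (0 : ℝ) < N := by linarith
  have hlogN : 1 ≤ Real.log N := by
    have h16 : (1 : ℝ) ≤ Real.log 16 := by
      rw [Real.le_log_iff_exp_le (by norm_num)]
      exact Real.exp_one_lt_d9.le.trans (by norm_num)
    exact h16.trans (Real.log_le_log (by norm_num) hNr)
  have hlogN0 : 0 < Real.log N := by linarith
  set L : ℝ := γ * Real.log N with hL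
  have hL0 : 0 < L := by positivity
  -- the threshold `d* = ⌊N^{γ/2}⌋`
  set dstar : ℕ := ⌊(N : ℝ) ^ (γ / 2)⌋₊ with hdstar
  have hpow2 : (N : ℝ) ^ (γ / 2) = ((N : ℝ) ^ (γ / 4)) ^ 2 := by
    rw [← Real.rpow_natCast, ← Real.rpow_mul hN0.le]; norm_num; ring_nf
  have hNγ2 : (4 : ℝ) ≤ (N : ℝ) ^ (γ / 2) := by rw [hpow2]; nlinarith
  have hdstar4 : 4 ≤ dstar := by
    rw [hdstar]; exact Nat.le_floor (by exact_mod_cast hNγ2)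
  have hdstar_le : (dstar : ℝ) ≤ (N : ℝ) ^ (γ / 2) := Nat.floor_le (by positivity)
  have hdstar_gt : (N : ℝ) ^ (γ / 2) / 2 ≤ dstar := by
    have h1 : (N : ℝ) ^ (γ / 2) < dstar + 1 := Nat.lt_floor_add_one _
    linarith
  -- `log t ≥ (γ/4) log N` for `t ≥ d*`
  have hlog2 : Real.log 2 ≤ γ / 4 * Real.log N := by
    have := Real.log_le_log (by norm_num) hNγ
    rwa [Real.log_rpow hN0] at this
  have hlogt : ∀ t : ℕ, dstar ≤ t → γ / 4 * Real.log N ≤ Real.log t := by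
    intro t ht
    have ht' : (N : ℝ) ^ (γ / 2) / 2 ≤ t := hdstar_gt.trans (by exact_mod_cast ht)
    have hpos : (0 : ℝ) < (N : ℝ) ^ (γ / 2) / 2 := by positivity
    have h1 := Real.log_le_log hpos ht'
    rw [Real.log_div (by positivity) (by norm_num), Real.log_rpow hN0] at h1
    linarith
  -- the uniform bound on the partial sums for `t ∈ [d*, D]`
  set M₀ : ℝ := C * D * (4 / γ) ^ A / Real.log N ^ A with hM₀
  have hM₀0 : 0 ≤ M₀ := by positivity
  have hPt : ∀ t : ℕ, dstar ≤ t → t ≤ D →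
      |∑ d ∈ Icc 1 t, (ArithmeticFunction.moebius d : ℝ) * Ψ (d * e)| ≤ M₀ := by
    intro t ht htD
    have ht2 : 2 ≤ t := by omega
    refine (hP t ht2).trans ?_
    have hlt := hlogt t ht
    have hlt0 : 0 < Real.log t := lt_of_lt_of_le (by positivity) hlt
    have h1 : (γ / 4 * Real.log N) ^ A ≤ Real.log t ^ A :=
      Real.rpow_le_rpow (by positivity) hlt hA.le
    have h2 : (γ / 4 * Real.log N) ^ A = (γ / 4) ^ A * Real.log N ^ A :=
      Real.mul_rpow (by positivity) hlogN0.le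
    have h3 : (4 / γ) ^ A * (γ / 4) ^ A = 1 := by
      rw [← Real.mul_rpow (by positivity) (by positivity)]
      rw [show (4 / γ) * (γ / 4) = 1 by field_simp, Real.one_rpow]
    have htD' : (t : ℝ) ≤ D := by exact_mod_cast htD
    have hγA : 0 < (γ / 4) ^ A := by positivity
    calc C * t / Real.log t ^ A ≤ C * t / (γ / 4 * Real.log N) ^ A :=
          div_le_div_of_nonneg_left (by positivity) (by positivity) h1
      _ = C * t * (4 / γ) ^ A / Real.log N ^ A := by
          rw [h2]
          field_simp
          nlinarith [h3, hγA]
      _ ≤ C * D * (4 / γ) ^ A / Real.log N ^ A := by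
          gcongr
  -- the small divisors do not contribute
  have hzero : ∀ d ∈ Icc 1 dstar,
      (ArithmeticFunction.moebius d : ℝ) * flatWeight χ γ N d * Ψ (d * e) = 0 := by
    intro d hd
    rw [Finset.mem_Icc] at hd
    rw [flatWeight_eq_zero hχ0 hγ hN1 hd.1 ((show (d : ℝ) ≤ dstar by exact_mod_cast hd.2).trans
      hdstar_le), mul_zero, zero_mul]
  -- the target constant
  have hK : 0 ≤ 8 * (1 + Lχ) * C * (4 / γ) ^ A / γ * D / Real.log N ^ A := by positivity
  rcases le_or_gt D dstar with hDsmall | hDlarge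
  · -- everything vanishes
    rw [Finset.sum_eq_zero fun d hd => hzero d (Finset.Icc_subset_Icc_right hDsmall hd), abs_zero]
    exact hK
  -- split at `d*`
  have hsplit : ∑ d ∈ Icc 1 D, (ArithmeticFunction.moebius d : ℝ) * flatWeight χ γ N d * Ψ (d * e) =
      ∑ d ∈ Icc (dstar + 1) D,
        (ArithmeticFunction.moebius d : ℝ) * flatWeight χ γ N d * Ψ (d * e) := by
    have h := Finset.sum_Ioc_consecutive
      (fun d => (ArithmeticFunction.moebius d : ℝ) * flatWeight χ γ N d * Ψ (d * e))
      (Nat.zero_le dstar) hDlarge.le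
    have e0 : Finset.Ioc 0 dstar = Finset.Icc 1 dstar := (Finset.Icc_add_one_left_eq_Ioc 0 dstar).symm
    have e1 : Finset.Ioc dstar D = Finset.Icc (dstar + 1) D :=
      (Finset.Icc_add_one_left_eq_Ioc dstar D).symm
    have e2 : Finset.Ioc 0 D = Finset.Icc 1 D := (Finset.Icc_add_one_left_eq_Ioc 0 D).symm
    rw [e0, e1, e2] at h
    rw [← h, Finset.sum_eq_zero hzero, zero_add]
  rw [hsplit]
  -- summation by parts on `[d*+1, D]`
  have hDge : dstar + 1 ≤ D := hDlarge
  set u : ℕ → ℝ := fun d => flatWeight χ γ N d with hu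
  set v : ℕ → ℝ := fun d => (ArithmeticFunction.moebius d : ℝ) * Ψ (d * e) with hv
  have hrew : ∑ d ∈ Icc (dstar + 1) D,
      (ArithmeticFunction.moebius d : ℝ) * flatWeight χ γ N d * Ψ (d * e) =
      ∑ d ∈ Icc (dstar + 1) D, u d * v d :=
    Finset.sum_congr rfl fun d _ => by simp only [hu, hv]; ring
  rw [hrew]
  -- partial sums over `[d*+1, t]` are differences of initial segments
  have hQ : ∀ t ∈ Icc (dstar + 1) D, |∑ i ∈ Icc (dstar + 1) t, v i| ≤ 2 * M₀ := by
    intro t ht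
    rw [Finset.mem_Icc] at ht
    have h := Finset.sum_Ioc_consecutive v (Nat.zero_le dstar) (show dstar ≤ t by omega)
    have e0 : Finset.Ioc 0 dstar = Finset.Icc 1 dstar := (Finset.Icc_add_one_left_eq_Ioc 0 dstar).symm
    have e1 : Finset.Ioc dstar t = Finset.Icc (dstar + 1) t :=
      (Finset.Icc_add_one_left_eq_Ioc dstar t).symm
    have e2 : Finset.Ioc 0 t = Finset.Icc 1 t := (Finset.Icc_add_one_left_eq_Ioc 0 t).symm
    rw [e0, e1, e2] at h
    have e1 : ∑ i ∈ Icc (dstar + 1) t, v i = ∑ i ∈ Icc 1 t, v i - ∑ i ∈ Icc 1 dstar, v i := by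
      rw [← h]; ring
    rw [e1]
    have b1 := hPt t (by omega) ht.2
    have b2 := hPt dstar le_rfl (by omega)
    calc |∑ i ∈ Icc 1 t, v i - ∑ i ∈ Icc 1 dstar, v i|
        ≤ |∑ i ∈ Icc 1 t, v i| + |∑ i ∈ Icc 1 dstar, v i| := abs_sub _ _
      _ ≤ M₀ + M₀ := add_le_add b1 b2
      _ = 2 * M₀ := by ring
  have habel := abs_sum_Icc_mul_le_parts u v (dstar + 1) D (by positivity) hQ
  refine habel.trans ?_
  -- the variation of `u`
  have hD1 : 1 ≤ D := by omega
  have hxD : Real.log D / L ≤ 2 / γ := by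
    rw [hL, div_le_div_iff₀ hL0 hγ, mul_comm]
    have hlogD : Real.log D ≤ 2 * Real.log N := by
      calc Real.log D ≤ Real.log ((N : ℝ) ^ 2) := Real.log_le_log (by exact_mod_cast hD1) hD
        _ = 2 * Real.log N := by rw [Real.log_pow]; push_cast; ring
    nlinarith
  have huD : |u D| ≤ (1 + Lχ) * (Real.log D / L) := abs_flatWeight_le hχ0 hχL hγ hN1 hD1
  have hvar : ∑ d ∈ Ico (dstar + 1) D, |u (d + 1) - u d| ≤ (1 + Lχ) * (Real.log D / L) := by
    refine (sum_abs_flatWeight_sub_le hχL hγ hN1 (by omega) hDge).trans ?_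
    rw [← hL]
    have h0 : 0 ≤ Real.log ((dstar + 1 : ℕ) : ℝ) / L :=
      div_nonneg (Real.log_nonneg (by exact_mod_cast Nat.succ_pos dstar)) hL0.le
    nlinarith
  have hcoef : |u D| + ∑ d ∈ Ico (dstar + 1) D, |u (d + 1) - u d| ≤ 2 * (1 + Lχ) * (2 / γ) := by
    have h1 : (1 + Lχ) * (Real.log D / L) ≤ (1 + Lχ) * (2 / γ) :=
      mul_le_mul_of_nonneg_left hxD (by positivity)
    linarith
  calc (|u D| + ∑ d ∈ Ico (dstar + 1) D, |u (d + 1) - u d|) * (2 * M₀)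
      ≤ 2 * (1 + Lχ) * (2 / γ) * (2 * M₀) := mul_le_mul_of_nonneg_right hcoef (by positivity)
    _ = 8 * (1 + Lχ) * C * (4 / γ) ^ A / γ * D / Real.log N ^ A := by
        rw [hM₀]
        field_simp
        ring

end flatcore

section flatsum

variable {χ : ℝ → ℝ} {Lχ γ : ℝ}

/-- **The bound for the twisted divisor sum `T_r`** (proof of (12.10): rearrangement
`n = dm`, the vanishing below `R^{1/2}`, `MN(s)` for the dilated nilsequences with summation by
parts, and "absorbing the logarithmically divergent sum `∑_{m ∈ [N]} 1/m` into the `log^{-A} N`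
factor"): if for every dilation `e ≥ 1` the partial sums `|∑_{d ≤ t} μ(d) Ψ(de)|` are
`≤ C t log^{-A} t` (`t ≥ 2`), then for `1 ≤ A' ≤ B' + 1`, `B' ≤ N²`,
`|∑_{n=A'}^{B'} (∑_{d|n} μ(d) u_N(d)) Ψ(n)| ≤ 16 (1+L_χ) C (4/γ)^A γ⁻¹ · B'(1 + log B') log^{-A} N`.
[cite: GreenTao2010, §12 (proof of (12.10))] -/
theorem abs_sum_divisorSum_flatWeight_mul_le (hχ0 : ∀ x, 0 ≤ x → x ≤ 1 / 2 → χ x = x)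
    (hχL : ∀ x y, |χ x - χ y| ≤ Lχ * |x - y|) (hLχ : 0 ≤ Lχ) (hγ : 0 < γ) {A C : ℝ} (hA : 0 < A)
    (hC : 0 ≤ C) {N : ℕ} (hN : 16 ≤ N) (hNγ : (2 : ℝ) ≤ (N : ℝ) ^ (γ / 4)) (Ψ : ℕ → ℝ)
    (hP : ∀ e : ℕ, 1 ≤ e → ∀ t : ℕ, 2 ≤ t →
      |∑ d ∈ Icc 1 t, (ArithmeticFunction.moebius d : ℝ) * Ψ (d * e)| ≤ C * t / Real.log t ^ A)
    {A' B' : ℕ} (hA' : 1 ≤ A') (hAB : A' ≤ B' + 1) (hB : (B' : ℝ) ≤ (N : ℝ) ^ 2) :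
    |∑ n ∈ Icc A' B', (∑ d ∈ n.divisors, (ArithmeticFunction.moebius d : ℝ) * flatWeight χ γ N d) *
        Ψ n| ≤
      16 * (1 + Lχ) * C * (4 / γ) ^ A / γ * (B' * (1 + Real.log B')) / Real.log N ^ A := by
  set K₁ : ℝ := 8 * (1 + Lχ) * C * (4 / γ) ^ A / γ with hK₁
  have hK₁0 : 0 ≤ K₁ := by positivity
  have hN1 : (1 : ℝ) < N := by exact_mod_cast (show 1 < N by omega)
  have hlogN0 : 0 < Real.log N := Real.log_pos hN1
  -- Step 1: rearrangement `n = d e` and reduction to initial segments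
  set f : ℕ → ℕ → ℝ := fun d n => (ArithmeticFunction.moebius d : ℝ) * flatWeight χ γ N d * Ψ n
    with hf
  have h1 : ∑ n ∈ Icc A' B', (∑ d ∈ n.divisors, (ArithmeticFunction.moebius d : ℝ) *
      flatWeight χ γ N d) * Ψ n = ∑ n ∈ Icc A' B', ∑ d ∈ n.divisors, f d n := by
    refine Finset.sum_congr rfl fun n _ => ?_
    rw [Finset.sum_mul]
  rw [h1, sum_Icc_sum_divisors_eq hA' f]
  have h2 : ∀ e ∈ Icc 1 B', ∑ d ∈ (Icc 1 B').filter (fun d => A' ≤ d * e ∧ d * e ≤ B'), f d (d * e) =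
      ∑ d ∈ Icc 1 (B' / e), f d (d * e) - ∑ d ∈ Icc 1 ((A' - 1) / e), f d (d * e) := by
    intro e he
    rw [Finset.mem_Icc] at he
    exact sum_filter_mul_mem_eq_sub hA' hAB he.1 (fun d => f d (d * e))
  rw [Finset.sum_congr rfl h2]
  -- Step 2: the bound for each initial segment
  have hV : ∀ e : ℕ, 1 ≤ e → ∀ D : ℕ, (D : ℝ) ≤ (N : ℝ) ^ 2 →
      |∑ d ∈ Icc 1 D, f d (d * e)| ≤ K₁ * D / Real.log N ^ A := by
    intro e he D hD
    have := abs_sum_moebius_flatWeight_le hχ0 hχL hLχ hγ hA hC hN hNγ Ψ e (hP e he) hD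
    rw [hK₁]
    simpa only [hf] using this
  have hB'N : ∀ D : ℕ, D ≤ B' → (D : ℝ) ≤ (N : ℝ) ^ 2 := fun D hD =>
    le_trans (by exact_mod_cast hD) hB
  have hterm : ∀ e ∈ Icc 1 B',
      |∑ d ∈ Icc 1 (B' / e), f d (d * e) - ∑ d ∈ Icc 1 ((A' - 1) / e), f d (d * e)| ≤
        2 * K₁ * ((B' : ℝ) / e) / Real.log N ^ A := by
    intro e he
    rw [Finset.mem_Icc] at he
    have he0 : (0 : ℝ) < e := by exact_mod_cast he.1
    have hD1 : ((B' / e : ℕ) : ℝ) ≤ (B' : ℝ) / e := Nat.cast_div_le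
    have hD2 : (((A' - 1) / e : ℕ) : ℝ) ≤ (B' : ℝ) / e := by
      calc (((A' - 1) / e : ℕ) : ℝ) ≤ ((A' - 1 : ℕ) : ℝ) / e := Nat.cast_div_le
        _ ≤ (B' : ℝ) / e := by
            refine div_le_div_of_nonneg_right ?_ he0.le
            exact_mod_cast (show A' - 1 ≤ B' by omega)
    have b1 := hV e he.1 (B' / e) (hB'N _ (Nat.div_le_self _ _))
    have b2 := hV e he.1 ((A' - 1) / e) (hB'N _ ((Nat.div_le_self _ _).trans (by omega)))
    have hlogA : 0 < Real.log N ^ A := by positivity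
    calc _ ≤ |∑ d ∈ Icc 1 (B' / e), f d (d * e)| + |∑ d ∈ Icc 1 ((A' - 1) / e), f d (d * e)| :=
          abs_sub _ _
      _ ≤ K₁ * ((B' / e : ℕ) : ℝ) / Real.log N ^ A + K₁ * (((A' - 1) / e : ℕ) : ℝ) / Real.log N ^ A :=
          add_le_add b1 b2
      _ ≤ K₁ * ((B' : ℝ) / e) / Real.log N ^ A + K₁ * ((B' : ℝ) / e) / Real.log N ^ A := by
          gcongr
      _ = 2 * K₁ * ((B' : ℝ) / e) / Real.log N ^ A := by ring
  -- Step 3: sum over `e` with the harmonic bound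
  refine (Finset.abs_sum_le_sum_abs _ _).trans ((Finset.sum_le_sum hterm).trans ?_)
  have h3 : ∑ e ∈ Icc 1 B', 2 * K₁ * ((B' : ℝ) / e) / Real.log N ^ A =
      2 * K₁ * B' / Real.log N ^ A * ∑ e ∈ Icc 1 B', (1 : ℝ) / e := by
    rw [Finset.mul_sum]
    exact Finset.sum_congr rfl fun e _ => by ring
  rw [h3]
  have h4 := sum_Icc_inv_le_log B'
  have hlogB : 0 ≤ 1 + Real.log B' := by
    rcases Nat.eq_zero_or_pos B' with hB0 | hB0
    · subst hB0; simp
    · have : 0 ≤ Real.log B' := Real.log_nonneg (by exact_mod_cast hB0)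
      linarith
  calc 2 * K₁ * B' / Real.log N ^ A * ∑ e ∈ Icc 1 B', (1 : ℝ) / e
      ≤ 2 * K₁ * B' / Real.log N ^ A * (1 + Real.log B') :=
        mul_le_mul_of_nonneg_left h4 (by positivity)
    _ = 16 * (1 + Lχ) * C * (4 / γ) ^ A / γ * (B' * (1 + Real.log B')) / Real.log N ^ A := by
        rw [hK₁]; ring

end flatsum

/-! ### The substitution `n = (n' - b)/W` and the character expansion (§12, (12.8)–(12.9)) -/

section substitution

/-- **The substitution `n' = Wn + b`**: a sum over the residue class `n' ≡ b (W)` in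
`[W lo + b, W hi + b]` is the corresponding sum over `n ∈ [lo, hi]` (display (12.8)).
[cite: GreenTao2010, §12, (12.8)] -/
theorem sum_filter_dvd_sub_eq_sum {W : ℕ} (hW : 1 ≤ W) (b lo hi : ℕ) (Xf : ℕ → ℝ) :
    ∑ n' ∈ (Icc (W * lo + b) (W * hi + b)).filter (fun n' : ℕ => (W : ℤ) ∣ (n' : ℤ) - b), Xf n' =
      ∑ n ∈ Icc lo hi, Xf (W * n + b) := by
  have hW0 : 0 < W := hW
  symm
  refine Finset.sum_nbij' (fun n => W * n + b) (fun n' => (n' - b) / W) ?_ ?_ ?_ ?_ ?_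
  · intro n hn
    rw [Finset.mem_Icc] at hn
    rw [Finset.mem_filter, Finset.mem_Icc]
    refine ⟨⟨by nlinarith [hn.1], by nlinarith [hn.2]⟩, ⟨n, ?_⟩⟩
    push_cast
    ring
  · intro n' hn'
    rw [Finset.mem_filter, Finset.mem_Icc] at hn'
    obtain ⟨⟨h1, h2⟩, hdvd⟩ := hn'
    have hbn : b ≤ n' := le_trans (Nat.le_add_left b _) h1
    have hdvd' : W ∣ n' - b := by
      have : ((n' : ℤ) - b) = ((n' - b : ℕ) : ℤ) := by push_cast [hbn]; ring
      rw [this] at hdvd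
      exact Int.natCast_dvd_natCast.mp hdvd
    have hq : W * ((n' - b) / W) = n' - b := Nat.mul_div_cancel' hdvd'
    rw [Finset.mem_Icc]
    constructor
    · apply Nat.le_of_mul_le_mul_left _ hW0
      rw [hq]; omega
    · apply Nat.le_of_mul_le_mul_left _ hW0
      rw [hq]; omega
  · intro n _
    show (W * n + b - b) / W = n
    rw [Nat.add_sub_cancel, Nat.mul_div_cancel_left n hW0]
  · intro n' hn'
    rw [Finset.mem_filter, Finset.mem_Icc] at hn'
    obtain ⟨⟨h1, _⟩, hdvd⟩ := hn'
    have hbn : b ≤ n' := le_trans (Nat.le_add_left b _) h1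
    have hdvd' : W ∣ n' - b := by
      have : ((n' : ℤ) - b) = ((n' - b : ℕ) : ℤ) := by push_cast [hbn]; ring
      rw [this] at hdvd
      exact Int.natCast_dvd_natCast.mp hdvd
    show W * ((n' - b) / W) + b = n'
    rw [Nat.mul_div_cancel' hdvd']
    omega
  · intro n _
    rfl

/-- **The character expansion of the residue class** (before (12.10)): summing the twisted
sequences `cos(2π(-rb/W + n r/W)) G(n)` over `r ∈ ℤ_W` recovers `W` times the sum over
`n ≡ b (W)`. [cite: GreenTao2010, §12 (between (12.9) and (12.10))] -/
theorem sum_range_sum_twist_eq {W : ℕ} (hW : 1 ≤ W) (b : ℕ) (S : Finset ℕ) (c G : ℕ → ℝ) :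
    ∑ r ∈ Finset.range W, ∑ n ∈ S,
        c n * (Real.cos (2 * Real.pi * (-((r : ℝ) * b / W) + n * ((r : ℝ) / W))) * G n) =
      W * ∑ n ∈ S.filter (fun n : ℕ => (W : ℤ) ∣ (n : ℤ) - b), c n * G n := by
  rw [Finset.sum_comm]
  have hcos : ∀ n : ℕ, ∑ r ∈ Finset.range W,
      Real.cos (2 * Real.pi * (-((r : ℝ) * b / W) + n * ((r : ℝ) / W))) =
      if (W : ℤ) ∣ (n : ℤ) - b then (W : ℝ) else 0 := by
    intro n
    rw [← sum_cos_two_pi_mul_div hW ((n : ℤ) - b)]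
    refine Finset.sum_congr rfl fun r _ => ?_
    congr 1
    push_cast
    ring
  have h1 : ∀ n ∈ S, ∑ r ∈ Finset.range W,
      c n * (Real.cos (2 * Real.pi * (-((r : ℝ) * b / W) + n * ((r : ℝ) / W))) * G n) =
      (if (W : ℤ) ∣ (n : ℤ) - b then (W : ℝ) else 0) * (c n * G n) := by
    intro n _
    rw [← hcos n, Finset.sum_mul]
    exact Finset.sum_congr rfl fun r _ => by ring
  rw [Finset.sum_congr rfl h1, Finset.mul_sum, Finset.sum_filter]
  refine Finset.sum_congr rfl fun n _ => ?_
  split_ifs <;> simp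

end substitution

section flatmain

/-- `Λ♭_{b,W}` at level `R = N^γ` in terms of the rough weights `u_N(d)`:
`(φ(W)/W) Λ♭(Wn+b) = -(φ(W)/W)(γ log N) ∑_{d | Wn+b} μ(d) u_N(d)`. [cite: GreenTao2010, §12, (12.3)–(12.5)] -/
theorem vonMangoldtSmoothW_flat_eq (χ : ℝ → ℝ) (γ : ℝ) {N : ℕ} (hN : 0 < N) (W b n : ℕ) :
    vonMangoldtSmoothW (flatCutoff χ) ((N : ℝ) ^ γ) W b n =
      -((Nat.totient W : ℝ) / W * (γ * Real.log N)) *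
        ∑ d ∈ (W * n + b).divisors, (ArithmeticFunction.moebius d : ℝ) * flatWeight χ γ N d := by
  unfold vonMangoldtSmoothW vonMangoldtSmooth flatWeight
  rw [Real.log_rpow (by exact_mod_cast hN)]
  ring

/-- **`MN(s)` on `X^m × ℝ/ℤ` bounds the twisted, dilated product nilsequences on `X`**: for
`1`-bounded `K`-Lipschitz `H_j`, `h ∈ G`, base points `y'_j`, a frequency `θ`, a phase `φ` and a
dilation `e`, `|∑_{d ≤ t} μ(d) cos(2π(φ + deθ)) ∏_j H_j(h^{de} y'_j)| ≤ C t log^{-A} t` with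
`C = C(m, K, A, X)` — the sequence is the nilsequence of one fixed Lipschitz function on
`X^m × ℝ/ℤ` along the orbit of the `e`-th power of `((h,…,h), θ)`, and "the bounds in the `MN(s)`
conjecture are uniform in the `g` parameter". [cite: GreenTao2010, §12 (proof of (12.10)) and Conj. 8.5] -/
theorem abs_sum_moebius_twisted_le_of_MN {s : ℕ} (hs : 1 ≤ s) (X : Nilmanifold s)
    (hMN : ∀ (m : ℕ) (M : ℝ), GreenTao2010_MNAt s ((X.pow m).prod (Nilmanifold.circle.ofLE hs)) M)
    (m : ℕ) {K : ℝ} (hK : 0 ≤ K) {A : ℝ} (hA : 0 < A) :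
    ∃ C : ℝ, 0 ≤ C ∧ ∀ (H : Fin m → X.G ⧸ X.Γ → ℝ), (∀ j, X.IsBoundedLipschitz K (H j)) →
      ∀ (h : X.G) (y' : Fin m → X.G ⧸ X.Γ) (θ φ : ℝ) (e t : ℕ), 2 ≤ t →
        |∑ d ∈ Icc 1 t, (ArithmeticFunction.moebius d : ℝ) *
            (Real.cos (2 * Real.pi * (φ + ((d * e : ℕ) : ℝ) * θ)) * ∏ j, H j (h ^ (d * e) • y' j))| ≤
          C * t / Real.log t ^ A := by
  obtain ⟨C, hC⟩ := hMN m (m * K + 2 * Real.pi) A hA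
  refine ⟨max C 0, le_max_right _ _, fun H hH h y' θ φ e t ht => ?_⟩
  obtain ⟨F, a, hF, hForb⟩ := X.exists_twisted_pow_nilsequence hs m hK H hH y'
  have h0 := hC t ht
    ((((X.diagHom m h, Multiplicative.ofAdd θ) : (X.pow m).G × (Nilmanifold.circle.ofLE hs).G)) ^ e)
    (QuotientGroup.mk ((a, Multiplicative.ofAdd φ) : (X.pow m).G × (Nilmanifold.circle.ofLE hs).G) :
      ((X.pow m).G × (Nilmanifold.circle.ofLE hs).G) ⧸
        (X.pow m).Γ.prod (Nilmanifold.circle.ofLE hs).Γ)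
    F hF
  change |∑ n ∈ Icc 1 t, (ArithmeticFunction.moebius n : ℝ) *
      F (((((X.diagHom m h, Multiplicative.ofAdd θ) :
        (X.pow m).G × (Nilmanifold.circle.ofLE hs).G)) ^ e) ^ n •
        (QuotientGroup.mk ((a, Multiplicative.ofAdd φ) :
          (X.pow m).G × (Nilmanifold.circle.ofLE hs).G) :
            ((X.pow m).G × (Nilmanifold.circle.ofLE hs).G) ⧸
              (X.pow m).Γ.prod (Nilmanifold.circle.ofLE hs).Γ))| ≤ C * t / Real.log t ^ A at h0
  simp_rw [← pow_mul', hForb] at h0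
  refine h0.trans ?_
  have ht0 : (0 : ℝ) ≤ Real.log t ^ A :=
    Real.rpow_nonneg (Real.log_nonneg (by exact_mod_cast (show 1 ≤ t by omega))) _
  exact div_le_div_of_nonneg_right
    (mul_le_mul_of_nonneg_right (le_max_left _ _) (Nat.cast_nonneg t)) ht0

variable {χ : ℝ → ℝ} {Lχ γ : ℝ}

/-- **The flat orthogonality (12.7) from bounds for twisted, dilated product nilsequences**
(the second half of §12: (12.5) ⇐ (12.7) ⇐ (12.9) ⇐ (12.10)), for a nilmanifold `X` with
divisible Lie group, a Lipschitz cutoff `χ = χ♯` with `χ♯(x) = x` on `[0, ½]` (so that "`χ♭`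
vanishes for `|x| ≤ 1/2`"), and the level `R = N^γ`: substitute `n = (n' - b)/W` with a `W`-th
root `g' = g^{1/W}` (divisibility, (12.9)), expand `1_{n' ≡ b (W)}` into the characters
`e(r(n' - b)/W)`, rearrange `n' = de`, drop `d ≤ R^{1/2}`, bound the dilated Möbius sums
(hypothesis `hTw`, which `MN(s)` on `X^m × ℝ/ℤ` supplies: `abs_sum_moebius_twisted_le_of_MN`)
with a summation by parts, sum `∑_e 1/e ≪ log N`, and absorb the logarithms using `W ≤ log N`,
`Wn + b ≤ 2N log N`. [cite: GreenTao2010, §12, (12.7)–(12.10)] -/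
theorem GreenTao2010_flatOrthogonalAt_of_twisted {s : ℕ} (X : Nilmanifold s)
    (hdiv : X.IsDivisible) (hχ0 : ∀ x, 0 ≤ x → x ≤ 1 / 2 → χ x = x)
    (hχL : ∀ x y, |χ x - χ y| ≤ Lχ * |x - y|) (hLχ : 0 ≤ Lχ) (hγ : 0 < γ)
    (hTw : ∀ (m : ℕ) (K : ℝ), 0 ≤ K → ∃ C : ℝ, 0 ≤ C ∧
      ∀ (H : Fin m → X.G ⧸ X.Γ → ℝ), (∀ j, X.IsBoundedLipschitz K (H j)) →
        ∀ (h : X.G) (y' : Fin m → X.G ⧸ X.Γ) (θ φ : ℝ) (e t : ℕ), 2 ≤ t →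
          |∑ d ∈ Icc 1 t, (ArithmeticFunction.moebius d : ℝ) *
              (Real.cos (2 * Real.pi * (φ + ((d * e : ℕ) : ℝ) * θ)) *
                ∏ j, H j (h ^ (d * e) • y' j))| ≤ C * t / Real.log t ^ (4 : ℝ)) :
    GreenTao2010_flatOrthogonalAt s X χ (fun N => (N : ℝ) ^ γ) := by
  intro m K ε hε
  -- constants depending on `m, K, ε` (and `X, χ, γ`) only
  set K' : ℝ := max K 0 with hK'
  have hK'0 : 0 ≤ K' := le_max_right _ _
  obtain ⟨C₀, hC₀0, hC₀⟩ := hTw m K' hK'0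
  set K₀ : ℝ := 16 * (1 + Lχ) * C₀ * (4 / γ) ^ (4 : ℝ) / γ with hK₀
  have hK₀0 : 0 ≤ K₀ := by positivity
  -- thresholds
  obtain ⟨N₁, hN₁⟩ := Filter.eventually_atTop.mp (WTrick.eventually_nat_le_log (6 * γ * K₀ / ε + 4))
  have hev2 : ∀ᶠ N : ℕ in atTop, (2 : ℝ) ≤ (N : ℝ) ^ (γ / 4) :=
    ((tendsto_rpow_atTop (by positivity : 0 < γ / 4)).comp
      tendsto_natCast_atTop_atTop).eventually_ge_atTop 2
  obtain ⟨N₂, hN₂⟩ := Filter.eventually_atTop.mp hev2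
  refine ⟨0, max (max N₁ N₂) 16, ?_⟩
  intro N hN w _ hwlog b hb1 hbW hbcop H hH g y lo hi hlo hhi
  show |∑ n ∈ Icc lo hi, vonMangoldtSmoothW (flatCutoff χ) ((N : ℝ) ^ γ) (primorial w) b n *
      ∏ j, H j (g ^ n • y j)| ≤ ε * N
  have hNa := le_of_max_le_left hN
  have hN16 : 16 ≤ N := le_of_max_le_right hN
  have hlogN := hN₁ N (le_of_max_le_left hNa)
  have hNγ : (2 : ℝ) ≤ (N : ℝ) ^ (γ / 4) := hN₂ N (le_of_max_le_right hNa)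
  have hNpos : 0 < N := by omega
  have hN0 : (0 : ℝ) < N := by exact_mod_cast hNpos
  have hNr16 : (16 : ℝ) ≤ N := by exact_mod_cast hN16
  have hN3 : (3 : ℝ) ≤ N := by linarith
  have hquot : 0 ≤ 6 * γ * K₀ / ε := by positivity
  set ℓ : ℝ := Real.log N with hℓ
  have hℓ4 : 4 ≤ ℓ := by linarith
  have hℓ0 : 0 < ℓ := by linarith
  -- the modulus `W`
  obtain ⟨W, hWdef⟩ : ∃ W : ℕ, W = primorial w := ⟨_, rfl⟩
  rw [← hWdef]
  rw [← hWdef] at hbW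
  have hW1 : 1 ≤ W := by rw [hWdef]; exact Nat.one_le_iff_ne_zero.mpr (primorial_pos w).ne'
  have hW0r : (0 : ℝ) < W := by exact_mod_cast hW1
  have hWlog : (W : ℝ) ≤ ℓ := by rw [hWdef, hℓ]; exact WTrick.primorial_le_log hN3 hwlog
  -- empty ranges are trivial
  rcases lt_or_ge hi lo with hhilo | hlohi
  · rw [Finset.Icc_eq_empty (by omega), Finset.sum_empty, abs_zero]; positivity
  -- the `W`-th root of `g` and the shifted base points
  obtain ⟨h, hh⟩ := hdiv g W hW1
  obtain ⟨y', hy'⟩ : ∃ y' : Fin m → X.G ⧸ X.Γ, ∀ j, y' j = (h ^ b)⁻¹ • y j := ⟨_, fun _ => rfl⟩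
  have hK'H : ∀ j, X.IsBoundedLipschitz K' (H j) := fun j => (hH j).mono (le_max_left _ _)
  -- the twisted sequences and the product sequence, as explicit real sequences
  obtain ⟨G, hG⟩ : ∃ G : ℕ → ℝ, ∀ n', G n' = ∏ j, H j (h ^ n' • y' j) := ⟨_, fun _ => rfl⟩
  obtain ⟨Ψ, hΨ⟩ : ∃ Ψ : ℕ → ℕ → ℝ, ∀ r n', Ψ r n' =
      Real.cos (2 * Real.pi * (-((r : ℝ) * (b : ℝ) / (W : ℝ)) + (n' : ℝ) * ((r : ℝ) / (W : ℝ)))) *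
        G n' := ⟨_, fun _ _ => rfl⟩
  -- the twisted bound for the dilated sequences
  have hPr : ∀ r e : ℕ, 1 ≤ e → ∀ t : ℕ, 2 ≤ t →
      |∑ d ∈ Icc 1 t, (ArithmeticFunction.moebius d : ℝ) * Ψ r (d * e)| ≤
        C₀ * t / Real.log t ^ (4 : ℝ) := by
    intro r e _ t ht
    have := hC₀ H hK'H h y' ((r : ℝ) / (W : ℝ)) (-((r : ℝ) * (b : ℝ) / (W : ℝ))) e t ht
    simp_rw [hΨ, hG]
    exact this
  -- Step 1: `Λ♭_{b,W}` in terms of the divisor sums `c(n') = ∑_{d|n'} μ(d) u_N(d)`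
  obtain ⟨c, hc⟩ : ∃ c : ℕ → ℝ, ∀ n', c n' = ∑ d ∈ n'.divisors,
      (ArithmeticFunction.moebius d : ℝ) * flatWeight χ γ N d := ⟨_, fun _ => rfl⟩
  set T : ℝ := ∑ n ∈ Icc lo hi, c (W * n + b) * ∏ j, H j (g ^ n • y j) with hT
  have hS : ∑ n ∈ Icc lo hi, vonMangoldtSmoothW (flatCutoff χ) ((N : ℝ) ^ γ) W b n *
      ∏ j, H j (g ^ n • y j) = -((Nat.totient W : ℝ) / W * (γ * ℓ)) * T := by
    rw [hT, Finset.mul_sum]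
    refine Finset.sum_congr rfl fun n _ => ?_
    rw [vonMangoldtSmoothW_flat_eq χ γ hNpos W b n, hc, hℓ]
    ring
  -- Step 2: the orbit identity `h^{Wn+b} y'_j = gⁿ y_j`
  have horbit : ∀ n : ℕ, G (W * n + b) = ∏ j, H j (g ^ n • y j) := by
    intro n
    rw [hG]
    refine Finset.prod_congr rfl fun j _ => ?_
    rw [hy' j, smul_smul, pow_add, mul_assoc, mul_inv_cancel, mul_one, pow_mul, hh]
  -- Step 3: `W T = ∑_{r < W} T_r` (substitution and character expansion)
  have hTexp : (W : ℝ) * T =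
      ∑ r ∈ Finset.range W, ∑ n' ∈ Icc (W * lo + b) (W * hi + b), c n' * Ψ r n' := by
    have e1 : ∀ r ∈ Finset.range W, ∑ n' ∈ Icc (W * lo + b) (W * hi + b), c n' * Ψ r n' =
        ∑ n' ∈ Icc (W * lo + b) (W * hi + b),
          c n' * (Real.cos (2 * Real.pi * (-((r : ℝ) * b / W) + n' * ((r : ℝ) / W))) * G n') :=
      fun r _ => Finset.sum_congr rfl fun n' _ => by rw [hΨ]
    have e2 : ∑ r ∈ Finset.range W, ∑ n' ∈ Icc (W * lo + b) (W * hi + b),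
        c n' * (Real.cos (2 * Real.pi * (-((r : ℝ) * b / W) + n' * ((r : ℝ) / W))) * G n') =
        W * ∑ n' ∈ (Icc (W * lo + b) (W * hi + b)).filter
          (fun n' : ℕ => (W : ℤ) ∣ (n' : ℤ) - b), c n' * G n' :=
      sum_range_sum_twist_eq hW1 b _ c G
    have e3 : ∑ n' ∈ (Icc (W * lo + b) (W * hi + b)).filter
        (fun n' : ℕ => (W : ℤ) ∣ (n' : ℤ) - b), c n' * G n' =
        ∑ n ∈ Icc lo hi, c (W * n + b) * G (W * n + b) :=
      sum_filter_dvd_sub_eq_sum hW1 b lo hi _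
    rw [Finset.sum_congr rfl e1, e2, e3, hT]
    congr 1
    exact Finset.sum_congr rfl fun n _ => by rw [horbit n]
  -- Step 4: the bound for each `T_r`
  set Npp : ℕ := W * hi + b with hNpp
  have hbW' : (b : ℝ) ≤ W := by exact_mod_cast hbW
  have hhi' : (hi : ℝ) ≤ N := by exact_mod_cast hhi
  have hNpp_le : (Npp : ℝ) ≤ 2 * N * ℓ := by
    rw [hNpp]; push_cast
    have h1 : (W : ℝ) * hi ≤ W * N := mul_le_mul_of_nonneg_left hhi' hW0r.le
    have h2 : (W : ℝ) * N ≤ ℓ * N := mul_le_mul_of_nonneg_right hWlog hN0.le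
    have h3 : (W : ℝ) ≤ ℓ * N := by nlinarith
    linarith
  have hNpp2 : (Npp : ℝ) ≤ (N : ℝ) ^ 2 := by
    have h2ℓ : 2 * ℓ ≤ N := by rw [hℓ]; exact WTrick.two_mul_log_le hNr16
    nlinarith
  have hNpp1 : (1 : ℝ) ≤ Npp := by
    rw [hNpp]; exact_mod_cast (show 1 ≤ W * hi + b by omega)
  have hlogNpp : 1 + Real.log Npp ≤ 3 * ℓ := by
    have : Real.log Npp ≤ Real.log ((N : ℝ) ^ 2) := Real.log_le_log (by linarith) hNpp2
    rw [Real.log_pow] at this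
    push_cast at this
    linarith
  have hA'1 : 1 ≤ W * lo + b := by omega
  have hAB : W * lo + b ≤ Npp + 1 := by
    have := Nat.mul_le_mul_left W hlohi
    exact (Nat.add_le_add_right this b).trans (Nat.le_succ _)
  have hTr : ∀ r : ℕ, |∑ n' ∈ Icc (W * lo + b) (W * hi + b), c n' * Ψ r n'| ≤
      K₀ * (Npp * (1 + Real.log Npp)) / ℓ ^ (4 : ℝ) := by
    intro r
    have := abs_sum_divisorSum_flatWeight_mul_le hχ0 hχL hLχ hγ (A := 4) (by norm_num) hC₀0
      hN16 hNγ (Ψ r) (fun e he t ht => hPr r e he t ht) hA'1 hAB hNpp2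
    rw [hK₀, hℓ]
    refine le_trans (le_of_eq ?_) this
    congr 1
    exact Finset.sum_congr rfl fun n' _ => by rw [hc]
  -- Step 5: numerics
  have hlog4 : ℓ ^ (4 : ℝ) = ℓ ^ 4 := by
    rw [show (4 : ℝ) = ((4 : ℕ) : ℝ) by norm_num, Real.rpow_natCast]
  have hbound : K₀ * (Npp * (1 + Real.log Npp)) / ℓ ^ (4 : ℝ) ≤ 6 * K₀ * N / ℓ ^ 2 := by
    rw [hlog4, div_le_div_iff₀ (by positivity) (by positivity)]
    have hlogNpp0 : 0 ≤ 1 + Real.log Npp := by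
      have : 0 ≤ Real.log Npp := Real.log_nonneg hNpp1
      linarith
    have h1 : (Npp : ℝ) * (1 + Real.log Npp) ≤ 2 * N * ℓ * (3 * ℓ) :=
      mul_le_mul hNpp_le hlogNpp hlogNpp0 (by positivity)
    have h2 : K₀ * ((Npp : ℝ) * (1 + Real.log Npp)) ≤ K₀ * (2 * N * ℓ * (3 * ℓ)) :=
      mul_le_mul_of_nonneg_left h1 hK₀0
    have hℓ2 : 0 ≤ ℓ ^ 2 := by positivity
    calc K₀ * ((Npp : ℝ) * (1 + Real.log Npp)) * ℓ ^ 2 ≤ K₀ * (2 * N * ℓ * (3 * ℓ)) * ℓ ^ 2 :=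
          mul_le_mul_of_nonneg_right h2 hℓ2
      _ = 6 * K₀ * N * ℓ ^ 4 := by ring
  have hTabs : |T| ≤ 6 * K₀ * N / ℓ ^ 2 := by
    have h1 : (W : ℝ) * |T| ≤ W * (6 * K₀ * N / ℓ ^ 2) := by
      calc (W : ℝ) * |T| = |(W : ℝ) * T| := by rw [abs_mul, abs_of_pos hW0r]
        _ ≤ ∑ r ∈ Finset.range W, |∑ n' ∈ Icc (W * lo + b) (W * hi + b), c n' * Ψ r n'| := by
            rw [hTexp]; exact Finset.abs_sum_le_sum_abs _ _
        _ ≤ ∑ _r ∈ Finset.range W, (6 * K₀ * N / ℓ ^ 2) :=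
            Finset.sum_le_sum fun r _ => (hTr r).trans hbound
        _ = W * (6 * K₀ * N / ℓ ^ 2) := by
            rw [Finset.sum_const, Finset.card_range, nsmul_eq_mul]
    exact le_of_mul_le_mul_left h1 hW0r
  -- Step 6: conclusion
  rw [hS, abs_mul]
  have hpref : |-((Nat.totient W : ℝ) / W * (γ * ℓ))| ≤ γ * ℓ := by
    rw [abs_neg, abs_of_nonneg (by positivity)]
    have hφ : (Nat.totient W : ℝ) / W ≤ 1 := by
      rw [div_le_one hW0r]; exact_mod_cast Nat.totient_le W
    calc (Nat.totient W : ℝ) / W * (γ * ℓ) ≤ 1 * (γ * ℓ) :=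
          mul_le_mul_of_nonneg_right hφ (by positivity)
      _ = γ * ℓ := one_mul _
  have hfinal : γ * ℓ * (6 * K₀ * N / ℓ ^ 2) ≤ ε * N := by
    have e : γ * ℓ * (6 * K₀ * N / ℓ ^ 2) = 6 * γ * K₀ / ℓ * N := by
      field_simp
    rw [e]
    refine mul_le_mul_of_nonneg_right ?_ hN0.le
    rw [div_le_iff₀ hℓ0]
    have : 6 * γ * K₀ / ε ≤ ℓ := by linarith
    rw [div_le_iff₀ hε] at this
    linarith
  calc |-((Nat.totient W : ℝ) / W * (γ * ℓ))| * |T| ≤ γ * ℓ * (6 * K₀ * N / ℓ ^ 2) :=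
        mul_le_mul hpref hTabs (abs_nonneg _) (by positivity)
    _ ≤ ε * N := hfinal

/-- **The flat orthogonality (12.7) from the `MN(s)` conjecture** on the nilmanifolds
`X^m × ℝ/ℤ` (`s ≥ 1`), for `X` divisible, `χ = χ♯` Lipschitz with `χ♯(x) = x` on `[0, ½]`, and
`R = N^γ` — the second half of §12 as printed ("We will eventually apply the `MN(s)`
conjecture …", (12.7)–(12.10)). [cite: GreenTao2010, §12, (12.7)–(12.10) and Conj. 8.5] -/
theorem GreenTao2010_flatOrthogonalAt_of_MN {s : ℕ} (hs : 1 ≤ s) (X : Nilmanifold s)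
    (hdiv : X.IsDivisible) (hχ0 : ∀ x, 0 ≤ x → x ≤ 1 / 2 → χ x = x)
    (hχL : ∀ x y, |χ x - χ y| ≤ Lχ * |x - y|) (hLχ : 0 ≤ Lχ) (hγ : 0 < γ)
    (hMN : ∀ (m : ℕ) (M : ℝ), GreenTao2010_MNAt s ((X.pow m).prod (Nilmanifold.circle.ofLE hs)) M) :
    GreenTao2010_flatOrthogonalAt s X χ (fun N => (N : ℝ) ^ γ) :=
  GreenTao2010_flatOrthogonalAt_of_twisted X hdiv hχ0 hχL hLχ hγ fun m K hK =>
    abs_sum_moebius_twisted_le_of_MN hs X hMN m hK (by norm_num)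

end flatmain

/-! ### Divisibility: examples -/

namespace Nilmanifold

/-- `ℝ` is divisible: the circle nilmanifold satisfies the divisibility hypothesis. [folklore] -/
theorem isDivisible_circle : circle.IsDivisible := by
  intro g q hq
  have hq0 : (q : ℝ) ≠ 0 := by exact_mod_cast (show q ≠ 0 by omega)
  refine ⟨(Multiplicative.ofAdd (Multiplicative.toAdd (show Multiplicative ℝ from g) / (q : ℝ)) :
    Multiplicative ℝ), ?_⟩
  show (Multiplicative.ofAdd (Multiplicative.toAdd (show Multiplicative ℝ from g) / (q : ℝ)) :
    Multiplicative ℝ) ^ q = (show Multiplicative ℝ from g)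
  rw [← ofAdd_nsmul, nsmul_eq_mul, mul_div_cancel₀ _ hq0, ofAdd_toAdd]

/-- Divisibility passes to `Nilmanifold.ofLE`. [folklore] -/
theorem isDivisible_ofLE {s s' : ℕ} (X : Nilmanifold s) (h : s ≤ s') (hX : X.IsDivisible) :
    (X.ofLE h).IsDivisible := hX

/-- Divisibility is preserved by products. [folklore] -/
theorem isDivisible_prod {s : ℕ} (X Y : Nilmanifold s) (hX : X.IsDivisible) (hY : Y.IsDivisible) :
    (X.prod Y).IsDivisible := by
  rintro ⟨g₁, g₂⟩ q hq
  obtain ⟨h₁, hh₁⟩ := hX g₁ q hq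
  obtain ⟨h₂, hh₂⟩ := hY g₂ q hq
  refine ⟨((h₁, h₂) : X.G × Y.G), ?_⟩
  show ((h₁, h₂) : X.G × Y.G) ^ q = (g₁, g₂)
  rw [Prod.pow_mk, hh₁, hh₂]

/-- Divisibility is preserved by powers. [folklore] -/
theorem isDivisible_pow {s : ℕ} (X : Nilmanifold s) (hX : X.IsDivisible) (m : ℕ) : (X.pow m).IsDivisible := by
  induction m with
  | zero =>
    intro g q _
    refine ⟨g, ?_⟩
    haveI : Subsingleton ((Fin 0 → ℝ)ˣ) := inferInstance
    exact Subsingleton.elim (α := (Fin 0 → ℝ)ˣ) _ _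
  | succ m ih => exact isDivisible_prod X (X.pow m) hX ih

end Nilmanifold

/-! ### What Thm. 7.2 now rests on -/

/-- The level `R = N^γ` has `log R ≠ 0` eventually (`γ > 0`). [folklore] -/
theorem eventually_log_rpow_ne_zero {γ : ℝ} (hγ : 0 < γ) :
    ∀ᶠ N : ℕ in atTop, Real.log ((N : ℝ) ^ γ) ≠ 0 := by
  filter_upwards [Filter.eventually_ge_atTop 2] with N hN
  have hN : (1 : ℝ) < N := by exact_mod_cast hN
  rw [Real.log_rpow (by linarith)]
  exact (mul_pos hγ (Real.log_pos hN)).ne'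

/-- **`GreenTao2010_gowersUniformity` from the four external inputs: Lemma E.9 (Mal'cev) and
divisibility (the Lie correspondence), `GI(s)` as printed, `MN(s)` as printed, and the sharp
Goldston–Yıldırım estimate (12.6) for some admissible cutoff `χ♯` and exponent `γ`** — with
§§4–7 and §§10–12 (both halves of §12) and Apps. A–C, E of the paper theorems of the tree, and
App. D except its `a = 1` case (12.6). [cite: GreenTao2010, Thm. 7.2, §§10–12, Conj. 8.3, Conj. 8.5, App. D, App. E] -/
theorem GreenTao2010_gowersUniformity_of_malcev_of_GI_of_MN_of_sharp
    (hE9 : ∀ (s : ℕ) (X : Nilmanifold s), X.IsRational)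
    (hdiv : ∀ (s : ℕ) (X : Nilmanifold s), X.IsDivisible)
    (hGI : ∀ s : ℕ, 1 ≤ s → ∀ δ : ℝ, 0 < δ → δ ≤ 1 → GreenTao2010_inverseConjectureAt s δ)
    (hMN : ∀ s : ℕ, 1 ≤ s → ∀ (Y : Nilmanifold s) (M : ℝ), GreenTao2010_MNAt s Y M)
    (hSharp : ∀ s : ℕ, 1 ≤ s → ∃ (χ : ℝ → ℝ) (Lχ γ : ℝ),
      (∀ x, 0 ≤ x → x ≤ 1 / 2 → χ x = x) ∧ (∀ x y, |χ x - χ y| ≤ Lχ * |x - y|) ∧ 0 ≤ Lχ ∧ 0 < γ ∧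
        GreenTao2010_sharpUniformAt s χ fun N => (N : ℝ) ^ γ) :
    GreenTao2010_gowersUniformity :=
  GreenTao2010_gowersUniformity_of_malcev_of_GI_of_sharp_of_flat hE9 hGI fun s hs => by
    obtain ⟨χ, Lχ, γ, hχ0, hχL, hLχ, hγ, hS⟩ := hSharp s hs
    exact ⟨χ, fun N => (N : ℝ) ^ γ, eventually_log_rpow_ne_zero hγ, hS, fun X =>
      GreenTao2010_flatOrthogonalAt_of_MN hs X (hdiv s X) hχ0 hχL hLχ hγ fun m M => hMN s hs _ M⟩

/-- **The Green–Tao–Ziegler theorem from Lemma E.9 + divisibility, `GI(s)`, `MN(s)` and (12.6).**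
[cite: GreenTao2010, Main Theorem, §§10–12] [cite: GreenTaoZiegler2012, Thm. 1.3] -/
theorem GreenTaoZiegler2012_finiteComplexity_of_malcev_of_GI_of_MN_of_sharp
    (hE9 : ∀ (s : ℕ) (X : Nilmanifold s), X.IsRational)
    (hdiv : ∀ (s : ℕ) (X : Nilmanifold s), X.IsDivisible)
    (hGI : ∀ s : ℕ, 1 ≤ s → ∀ δ : ℝ, 0 < δ → δ ≤ 1 → GreenTao2010_inverseConjectureAt s δ)
    (hMN : ∀ s : ℕ, 1 ≤ s → ∀ (Y : Nilmanifold s) (M : ℝ), GreenTao2010_MNAt s Y M)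
    (hSharp : ∀ s : ℕ, 1 ≤ s → ∃ (χ : ℝ → ℝ) (Lχ γ : ℝ),
      (∀ x, 0 ≤ x → x ≤ 1 / 2 → χ x = x) ∧ (∀ x y, |χ x - χ y| ≤ Lχ * |x - y|) ∧ 0 ≤ Lχ ∧ 0 < γ ∧
        GreenTao2010_sharpUniformAt s χ fun N => (N : ℝ) ^ γ) :
    GreenTaoZiegler2012_finiteComplexity :=
  GreenTaoZiegler2012_finiteComplexity_of_gowersUniformity
    (GreenTao2010_gowersUniformity_of_malcev_of_GI_of_MN_of_sharp hE9 hdiv hGI hMN hSharp)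

end Literature.NumberTheory.Sieve
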